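import Summits.CriticalPhenomena.Ising3DConformalLimit.Theorems.ArmDressingArmDressingGlueDefs
import HarnessLib

/-!
# Route `ArmDressing`, crux `ArmDressingGlue` (stmt-CriticalPhenomena-15700):
# stub `stub_dressedLimitExists`

The existence half of Camia–Feng (arXiv:2411.01467, Thm 1, §3.2.2) transposed to `ℤ³`, in the
vocabulary of `ArmDressingArmDressingGlueDefs`: from crux B (`EvenPatternDecoupling`, clause (i)),
crux C (`ArmExtensionFactorisation`, clause (i)) and the support ES (`InfiniteVolumeEdwardsSokal`,
clause (c), the infinite-volume Edwards–Sokal identity), the `ρ₁`-renormalised critical correlators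
`ρ₁(δ)ⁿ ⟨σ_{[z₁/δ]} ⋯ σ_{[zₙ/δ]}⟩⁺_{β_c}`, `ρ₁ = 1/arm1(·,1)`, converge locally uniformly on
non-coincident configurations to a family `S` with `S₂ > 0`.

Proof.  `S n z` is the pointwise `limUnder`.  A general lemma
(`tendstoLocallyUniformlyOn_limUnder`) reduces local uniformity to JOINT convergence, in the mesh
`δ → 0⁺` and the configuration `w → z`, near every non-coincident `z`.  Near such a `z` and for
small `δ` the lattice approximations `[w_j/δ]` are pairwise distinct
(`eventually_injective_latticeApprox`), so ES(c) applies: `ρ₁ⁿ⟨∏σ⟩ = P[EVEN]/arm1ⁿ`.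
* `n ≥ 2` even: on a product of small balls around `z`, B(i) and C(i) give
  `P[EVEN]/P[CROSS] → q` and `P[CROSS]/arm1ⁿ → v` locally uniformly with `q, v` continuous and
  positive, hence jointly; eventually `P[CROSS] ≠ 0` (its ratio tends to `v z > 0`), so
  `P[EVEN]/arm1ⁿ = (P[EVEN]/P[CROSS]) · (P[CROSS]/arm1ⁿ) → q z · v z > 0`.
* `n` odd: once all marked points lie in the box, "joined by an open path" is an equivalence
  relation on the indices whose classes would all be even, partitioning `Fin n` — impossible; so
  the `EVEN` event is empty, its wired-box probability is `0` for large boxes and `P[EVEN] = 0`.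
* `n = 0`: the `EVEN` event is everything, `P[EVEN] = 1`, the rescaled correlator is constant `1`.
Non-degeneracy is the case `n = 2`: `S₂(z) = q z · v z > 0`.

References: F. Camia, Y. Feng, arXiv:2411.01467 (SPA 2025), Thm 1 and §3.2.2.
-/

noncomputable section

namespace Summit.CriticalPhenomena.Ising3DConformalLimit.Cruxes.ArmDressingGlue.DressedLimitProof

open Summit.CriticalPhenomena.Ising3DConformalLimit.Cruxes.ArmDressingGlue.Vocab
open scoped Topology BigOperators
open Filter MeasureTheory Literature.Probability.LatticeModels Literature.Probability.Percolation
open Literature.Barriers.CriticalPhenomena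
open Summit.CriticalPhenomena.Ising3DConformalLimit.Theses

/-! ### Two general lemmas on joint versus locally uniform convergence -/

/-- If, near every point `x` of `s`, `F i y` converges jointly in the index `i → p` and the point
`y → x`, then `F` converges locally uniformly on `s` to its pointwise limit. [folklore] -/
theorem tendstoLocallyUniformlyOn_limUnder {α ι : Type*} [TopologicalSpace α] {p : Filter ι}
    [p.NeBot] {F : ι → α → ℝ} {s : Set α}
    (h : ∀ x ∈ s, ∃ L : ℝ, Tendsto (fun y : ι × α => F y.1 y.2) (p ×ˢ 𝓝 x) (𝓝 L)) :
    TendstoLocallyUniformlyOn F (fun x => limUnder p fun i => F i x) p s := by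
  have hpt : ∀ (x : α) (L : ℝ), Tendsto (fun y : ι × α => F y.1 y.2) (p ×ˢ 𝓝 x) (𝓝 L) →
      Tendsto (fun i => F i x) p (𝓝 L) := fun x L hL =>
    hL.comp (tendsto_id.prodMk tendsto_const_nhds)
  refine Metric.tendstoLocallyUniformlyOn_iff.2 fun ε hε x hx => ?_
  obtain ⟨L, hL⟩ := h x hx
  have hε3 : (0:ℝ) < ε / 3 := by positivity
  obtain ⟨A, hA, T, hT, hAT⟩ := Filter.mem_prod_iff.1 (hL (Metric.ball_mem_nhds L hε3))
  refine ⟨T ∩ s, inter_mem (mem_nhdsWithin_of_mem_nhds hT) self_mem_nhdsWithin, ?_⟩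
  filter_upwards [hA] with i hi y hy
  have hyA : ∀ i' ∈ A, dist (F i' y) L < ε / 3 := fun i' hi' => hAT (Set.mk_mem_prod hi' hy.1)
  obtain ⟨L', hL'⟩ := h y hy.2
  have hy' : Tendsto (fun i => F i y) p (𝓝 L') := hpt y L' hL'
  rw [hy'.limUnder_eq]
  have hL'L : dist L' L ≤ ε / 3 :=
    le_of_tendsto (hy'.dist tendsto_const_nhds) (mem_of_superset hA fun i' hi' => (hyA i' hi').le)
  calc dist L' (F i y) ≤ dist L' L + dist L (F i y) := dist_triangle _ _ _
    _ < ε := by rw [dist_comm L (F i y)]; linarith [hyA i hi]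

/-- A locally uniform limit on a neighbourhood of `x`, with limit function continuous there,
converges jointly in the index and the point. [folklore] -/
theorem tendsto_prod_of_tendstoLocallyUniformlyOn {α ι : Type*} [TopologicalSpace α] {p : Filter ι}
    {F : ι → α → ℝ} {f : α → ℝ} {s : Set α} {x : α}
    (h : TendstoLocallyUniformlyOn F f p s) (hf : ContinuousOn f s) (hs : s ∈ 𝓝 x) :
    Tendsto (fun y : ι × α => F y.1 y.2) (p ×ˢ 𝓝 x) (𝓝 (f x)) := by
  have hx : x ∈ s := mem_of_mem_nhds hs
  have h1 := (tendstoLocallyUniformlyOn_iff_forall_tendsto.1 h) x hx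
  rw [nhdsWithin_eq_nhds.2 hs] at h1
  have h2 : Tendsto (fun y : ι × α => f y.2) (p ×ˢ 𝓝 x) (𝓝 (f x)) :=
    (hf.continuousAt hs).tendsto.comp tendsto_snd
  exact Uniform.tendsto_nhds_right.2 ((Uniform.tendsto_nhds_right.1 h2).uniformity_trans h1)

/-! ### Lattice approximations of nearby non-coincident configurations -/

/-- Near an injective configuration `z` and for small mesh `δ`, the lattice approximations
`[w_j/δ]` are pairwise distinct, jointly in `(δ, w)`: a coordinate where `z_j, z_k` differ by `ε`
still differs by `> ε/3 > δ` for `w` near `z`, while equal integer parts force a difference `< δ`.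
[folklore] -/
theorem eventually_injective_latticeApprox {n : ℕ} {z : Fin n → EuclideanSpace ℝ (Fin 3)}
    (hz : Function.Injective z) :
    ∀ᶠ y in (𝓝[>] (0:ℝ)) ×ˢ 𝓝 z, Function.Injective (fun i => latticeApprox y.1 (y.2 i)) := by
  have key : ∀ j k : Fin n, ∀ᶠ y in (𝓝[>] (0:ℝ)) ×ˢ 𝓝 z,
      latticeApprox y.1 (y.2 j) = latticeApprox y.1 (y.2 k) → j = k := by
    intro j k
    by_cases hjk : j = k
    · exact Filter.Eventually.of_forall fun _ _ => hjk
    obtain ⟨i, hi⟩ : ∃ i, z j i ≠ z k i := by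
      by_contra hcon
      push Not at hcon
      exact hjk (hz (PiLp.ext hcon))
    have hε : 0 < |z j i - z k i| / 3 := div_pos (abs_pos.2 (sub_ne_zero.2 hi)) three_pos
    have h1 : ∀ᶠ δ in 𝓝[>] (0:ℝ), 0 < δ ∧ δ < |z j i - z k i| / 3 := by
      filter_upwards [Ioo_mem_nhdsGT hε] with δ hδ
      exact hδ
    have hc : ∀ l : Fin n, Continuous fun w : Fin n → EuclideanSpace ℝ (Fin 3) => w l i := fun l =>
      (PiLp.continuous_apply 2 (fun _ : Fin 3 => ℝ) i).comp (continuous_apply l)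
    have h2 : ∀ l : Fin n, ∀ᶠ w in 𝓝 z, |w l i - z l i| < |z j i - z k i| / 3 := fun l => by
      have := Metric.tendsto_nhds.1 ((hc l).tendsto z) _ hε
      simpa only [Real.dist_eq] using this
    filter_upwards [h1.prod_mk ((h2 j).and (h2 k))]
    rintro ⟨δ, w⟩ ⟨⟨hδ0, hδ⟩, hwj, hwk⟩ heq
    exfalso
    have hfl : ⌊w j i / δ⌋ = ⌊w k i / δ⌋ := by
      have := congrFun heq i
      simpa only [latticeApprox_apply] using this
    have hlt := Int.abs_sub_lt_one_of_floor_eq_floor hfl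
    rw [← sub_div, abs_div, abs_of_pos hδ0, div_lt_one hδ0] at hlt
    have htri := abs_add_three (z j i - w j i) (w j i - w k i) (w k i - z k i)
    rw [show z j i - w j i + (w j i - w k i) + (w k i - z k i) = z j i - z k i by ring,
      abs_sub_comm (z j i) (w j i)] at htri
    linarith
  filter_upwards [Filter.eventually_all.2 fun j => Filter.eventually_all.2 (key j)] with y hy a b h
  exact hy a b h

/-! ### The even case: `B(i) · C(i)` -/

/-- Bookkeeping of `ρ₁ⁿ P[EVEN] = (P[EVEN]/X)(X/arm1ⁿ)`: for `X ≠ 0`,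
`a⁻¹ ^ n * E = E / X * (X / a ^ n)` (both sides vanish if `a = 0`, `n ≠ 0`). [folklore] -/
theorem inv_pow_mul_eq_div_mul_div {a E X : ℝ} (n : ℕ) (hX : X ≠ 0) :
    a⁻¹ ^ n * E = E / X * (X / a ^ n) := by
  rw [div_mul_div_comm, mul_comm E X, mul_div_mul_left _ _ hX, inv_pow, inv_mul_eq_div]

/-- **The even case** (Camia–Feng 2025, §3.2.2 transposed): near an injective configuration `z` of
an even number `n ≥ 2` of points, the `ρ₁`-rescaled critical `n`-point correlator converges,
jointly in the mesh and the configuration, to `q z · v z > 0`, where `q`, `v` are the limits of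
B(i) and C(i) on a product of small balls around `z` (by ES(c) and
`P[EVEN]/arm1ⁿ = (P[EVEN]/P[CROSS]) (P[CROSS]/arm1ⁿ)` once `P[CROSS] ≠ 0`).
[cite: CamiaFeng2025, Thm 1 and §3.2.2] -/
theorem tendsto_rescaled_even (hB : ArmDressing.EvenPatternDecoupling)
    (hC : ArmDressing.ArmExtensionFactorisation) (hE : EdwardsSokalIdentity) {n : ℕ} (hn2 : 2 ≤ n)
    (hn : Even n) {z : Fin n → EuclideanSpace ℝ (Fin 3)} (hz : Function.Injective z) :
    ∃ L : ℝ, 0 < L ∧ Tendsto (fun y : ℝ × (Fin n → EuclideanSpace ℝ (Fin 3)) =>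
      rescaledCorrelator (criticalCorr 3) rho1 n y.1 y.2) ((𝓝[>] 0) ×ˢ 𝓝 z) (𝓝 L) := by
  -- a radius with pairwise disjoint closed balls around the points of `z`
  obtain ⟨r, hr0, hr⟩ : ∃ r : ℝ, 0 < r ∧ ∀ j k, j ≠ k → r + r < dist (z j) (z k) := by
    have h1 : ∀ j k, ∀ᶠ r in 𝓝[>] (0:ℝ), j ≠ k → r + r < dist (z j) (z k) := by
      intro j k
      by_cases hjk : j = k
      · exact Filter.Eventually.of_forall fun _ h => (h hjk).elim
      have hd : 0 < dist (z j) (z k) := dist_pos.2 (hz.ne hjk)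
      filter_upwards [Ioo_mem_nhdsGT (half_pos hd)] with r hr _
      linarith [hr.2]
    obtain ⟨r, hr0, hr⟩ := ((eventually_mem_nhdsWithin (a := (0:ℝ)) (s := Set.Ioi 0)).and
      (Filter.eventually_all.2 fun j => Filter.eventually_all.2 (h1 j))).exists
    exact ⟨r, hr0, hr⟩
  have hdisj : ∀ j k, j ≠ k → Disjoint (Metric.closedBall (z j) r) (Metric.closedBall (z k) r) :=
    fun j k hjk => Metric.closedBall_disjoint_closedBall (hr j k hjk)
  -- B(i) and C(i) on the product of the balls `B(z j, r)`, a neighbourhood of `z`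
  obtain ⟨q, hqc, hqpos, hqlim, -⟩ :=
    evenPatternDecoupling_iff.1 hB n hn2 hn z (fun _ => r) (fun _ => hr0) hdisj
  obtain ⟨v, hvc, hvpos, hvlim, -⟩ :=
    armExtensionFactorisation_iff.1 hC n (by omega) z (fun _ => r) (fun _ => hr0) hdisj
  have hUo : IsOpen {w : Fin n → EuclideanSpace ℝ (Fin 3) | ∀ j, w j ∈ Metric.ball (z j) r} := by
    rw [Set.setOf_forall]
    exact isOpen_iInter_of_finite fun j => Metric.isOpen_ball.preimage (continuous_apply j)
  have hzU : ∀ j, z j ∈ Metric.ball (z j) r := fun j => Metric.mem_ball_self hr0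
  have hU := hUo.mem_nhds hzU
  have hq := tendsto_prod_of_tendstoLocallyUniformlyOn hqlim hqc hU
  have hv := tendsto_prod_of_tendstoLocallyUniformlyOn hvlim hvc hU
  -- eventually the CROSS probability is non-zero (its ratio to `arm1ⁿ` tends to `v z > 0`)
  have hX : ∀ᶠ y : ℝ × (Fin n → EuclideanSpace ℝ (Fin 3)) in (𝓝[>] 0) ×ˢ 𝓝 z,
      Pr (n + n) (Fin.append (pts n y.1 y.2) (fun j => disc y.1 (Metric.ball (z j) r)ᶜ))
        (CROSS n) ≠ 0 := by
    filter_upwards [hv.eventually_const_lt (hvpos z hzU)] with y hy h0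
    rw [h0, zero_div] at hy
    exact lt_irrefl _ hy
  -- the identity `ρ₁ⁿ ⟨∏σ⟩ = (P[EVEN]/P[CROSS]) (P[CROSS]/arm1ⁿ)`, eventually, and the limit
  refine ⟨q z * v z, mul_pos (hqpos z hzU) (hvpos z hzU), (hq.mul hv).congr' ?_⟩
  filter_upwards [hX, eventually_injective_latticeApprox hz] with y hX' hy
  rw [rescaledCorrelator_apply, hE n _ hy]
  exact (inv_pow_mul_eq_div_mul_div n hX').symm

/-! ### The odd case and `n = 0`: two elementary facts about the wired-box probabilities -/

/-- A wired-box probability of an event met by no configuration vanishes. [folklore] -/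
theorem PrL_eq_zero_of_forall_notMem {m : ℕ} (K : Fin m → Set (Site 3))
    (R : Set (Fin m → Fin m → Prop)) (L : ℕ)
    (h : ∀ ω : BondConfig (BoxV 3 L), (fun i j => ∃ a b : BoxV 3 L,
      a.1 ∈ K i ∧ b.1 ∈ K j ∧ (openGraph ω).Reachable a b) ∉ R) :
    PrL m K R L = 0 := by
  have hs : {ω : BondConfig (BoxV 3 L) | (fun i j => ∃ a b : BoxV 3 L,
      a.1 ∈ K i ∧ b.1 ∈ K j ∧ (openGraph ω).Reachable a b) ∈ R} = ∅ :=
    Set.eq_empty_of_forall_notMem h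
  show (μ L).real {ω : BondConfig (BoxV 3 L) | (fun i j => ∃ a b : BoxV 3 L,
      a.1 ∈ K i ∧ b.1 ∈ K j ∧ (openGraph ω).Reachable a b) ∈ R} = 0
  rw [hs, measureReal_empty]

/-- A wired-box probability of an event met by every configuration is one. [folklore] -/
theorem PrL_eq_one_of_forall_mem {m : ℕ} (K : Fin m → Set (Site 3))
    (R : Set (Fin m → Fin m → Prop)) (L : ℕ)
    (h : ∀ ω : BondConfig (BoxV 3 L), (fun i j => ∃ a b : BoxV 3 L,
      a.1 ∈ K i ∧ b.1 ∈ K j ∧ (openGraph ω).Reachable a b) ∈ R) :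
    PrL m K R L = 1 := by
  have hs : {ω : BondConfig (BoxV 3 L) | (fun i j => ∃ a b : BoxV 3 L,
      a.1 ∈ K i ∧ b.1 ∈ K j ∧ (openGraph ω).Reachable a b) ∈ R} = Set.univ :=
    Set.eq_univ_of_forall h
  show (μ L).real {ω : BondConfig (BoxV 3 L) | (fun i j => ∃ a b : BoxV 3 L,
      a.1 ∈ K i ∧ b.1 ∈ K j ∧ (openGraph ω).Reachable a b) ∈ R} = 1
  rw [hs, probReal_univ]

/-- If an equivalence relation on `Fin n` has all its classes `{j | R i j}` of even size, then `n`
is even: the classes partition `Fin n`. [folklore] -/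
theorem even_of_even_classes {n : ℕ} (R : Fin n → Fin n → Prop) (hrefl : ∀ i, R i i)
    (hsymm : ∀ i j, R i j → R j i) (htrans : ∀ i j k, R i j → R j k → R i k)
    (h : ∀ i, Even ({j | R i j} : Set (Fin n)).ncard) : Even n := by
  classical
  let cls : Fin n → Finset (Fin n) := fun i => Finset.univ.filter (R i ·)
  have hmem : ∀ i j, j ∈ cls i ↔ R i j := fun i j => by simp [cls]
  have hcls : ∀ a i, cls i = cls a ↔ R a i := by
    intro a i
    constructor
    · intro hai
      have : i ∈ cls a := by rw [← hai]; exact (hmem i i).2 (hrefl i)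
      exact (hmem a i).1 this
    · intro hai
      ext j
      rw [hmem, hmem]
      exact ⟨fun hij => htrans _ _ _ hai hij, fun haj => htrans _ _ _ (hsymm _ _ hai) haj⟩
  have hcard : ∀ a, (cls a).card = ({j | R a j} : Set (Fin n)).ncard := by
    intro a
    rw [← Set.ncard_coe_finset]
    congr 1
    ext j
    simp [cls]
  have hsum := Finset.card_eq_sum_card_image cls Finset.univ
  rw [Finset.card_univ, Fintype.card_fin] at hsum
  rw [hsum]
  refine Finset.even_sum _ fun c hc => ?_
  obtain ⟨a, -, rfl⟩ := Finset.mem_image.1 hc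
  have hfib : (Finset.univ.filter fun i => cls i = cls a) = cls a := by
    ext i
    simp only [Finset.mem_filter, Finset.mem_univ, true_and]
    rw [hcls, hmem]
  rw [hfib, hcard]
  exact h a

/-- Finitely many lattice points eventually lie in the boxes `Λ_L`. [folklore] -/
theorem eventually_forall_mem_box {n : ℕ} (x : Fin n → Site 3) :
    ∀ᶠ L : ℕ in atTop, ∀ j, x j ∈ box 3 L := by
  refine Filter.eventually_all.2 fun j => ?_
  have : ∀ᶠ L : ℕ in atTop, ∀ i, (x j i).natAbs ≤ L :=
    Filter.eventually_all.2 fun i => eventually_ge_atTop _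
  filter_upwards [this] with L hL
  rw [mem_box]
  intro i
  have := hL i
  omega

/-- **The odd case**: for an odd number of marked lattice points the infinite-volume probability of
the route's `EVEN` event vanishes — once all points lie in the box, "joined by an open path of the
box" is an equivalence relation on the indices, and classes of even size would force `n` even, so
the event is empty. [folklore] -/
theorem Pr_even_eq_zero_of_odd {n : ℕ} (hn : Odd n) (x : Fin n → Site 3) :
    Pr n (fun j => {x j}) (EVEN n) = 0 := by
  have hzero : (fun L => PrL n (fun j => {x j}) (EVEN n) L) =ᶠ[atTop] fun _ => (0:ℝ) := by
    filter_upwards [eventually_forall_mem_box x] with L hL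
    refine PrL_eq_zero_of_forall_notMem _ _ L fun ω hω => (Nat.not_even_iff_odd.2 hn) ?_
    refine even_of_even_classes (fun i j => ∃ a b : BoxV 3 L, a.1 ∈ ({x i} : Set (Site 3)) ∧
      b.1 ∈ ({x j} : Set (Site 3)) ∧ (openGraph ω).Reachable a b) ?_ ?_ ?_ hω
    · intro i
      exact ⟨⟨x i, hL i⟩, ⟨x i, hL i⟩, rfl, rfl, SimpleGraph.Reachable.refl _⟩
    · rintro i j ⟨a, b, ha, hb, hab⟩
      exact ⟨b, a, hb, ha, hab.symm⟩
    · rintro i j k ⟨a, b, ha, hb, hab⟩ ⟨b', c, hb', hc, hbc⟩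
      have hbb : b = b' :=
        Subtype.ext ((Set.mem_singleton_iff.1 hb).trans (Set.mem_singleton_iff.1 hb').symm)
      subst hbb
      exact ⟨a, c, ha, hc, hab.trans hbc⟩
  have ht : Tendsto (PrL n (fun j => {x j}) (EVEN n)) atTop (𝓝 0) :=
    tendsto_const_nhds.congr' hzero.symm
  exact ht.limUnder_eq

/-- **The case `n = 0`**: with no marked point the `EVEN` event is sure, so its infinite-volume
probability is `1`. [folklore] -/
theorem Pr_even_zero (x : Fin 0 → Site 3) : Pr 0 (fun j => {x j}) (EVEN 0) = 1 := by
  have h1 : ∀ L, PrL 0 (fun j => {x j}) (EVEN 0) L = 1 := fun L =>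
    PrL_eq_one_of_forall_mem _ _ L fun ω => fun i => i.elim0
  have ht : Tendsto (PrL 0 (fun j => {x j}) (EVEN 0)) atTop (𝓝 1) :=
    tendsto_const_nhds.congr' (Filter.Eventually.of_forall fun L => (h1 L).symm)
  exact ht.limUnder_eq

/-! ### The stub -/

/-- **Dressed existence** (registered stub `stub_dressedLimitExists` of the skeleton of
`ArmDressingGlue`; Camia–Feng 2025, Thm 1 existence half, §3.2.2 transposed to `ℤ³`): from B, C and
ES, the `ρ₁`-renormalised critical correlators have a pointwise scaling limit — the pointwise
`limUnder`, locally uniform by joint convergence near every non-coincident configuration (even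
`n ≥ 2`: `q·v` by B(i)·C(i)·ES(c); odd `n`: `0`; `n = 0`: `1`) — whose two-point function
`S₂ = q·v` is positive. [cite: CamiaFeng2025, Thm 1 and §3.2.2] -/
theorem stub_dressedLimitExists :
    ArmDressing.EvenPatternDecoupling → ArmDressing.ArmExtensionFactorisation →
      ArmDressing.InfiniteVolumeEdwardsSokal →
        ∃ S : CorrFamily 3,
          HasPointwiseScalingLimit (criticalCorr 3) rho1 S ∧ IsNondegenerateTwoPoint S := by
  intro hB hC hES
  have hE : EdwardsSokalIdentity := (infiniteVolumeEdwardsSokal_iff.1 hES).2.2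
  -- joint convergence (mesh and configuration) near every non-coincident configuration
  have key : ∀ (n : ℕ) (z : Fin n → EuclideanSpace ℝ (Fin 3)), z ∈ NonCoincident 3 n → ∃ L : ℝ,
      Tendsto (fun y : ℝ × (Fin n → EuclideanSpace ℝ (Fin 3)) =>
        rescaledCorrelator (criticalCorr 3) rho1 n y.1 y.2) ((𝓝[>] 0) ×ˢ 𝓝 z) (𝓝 L) := by
    intro n z hz
    rw [mem_nonCoincident] at hz
    rcases Nat.even_or_odd n with hn | hn
    · rcases Nat.eq_zero_or_pos n with h0 | h0
      · subst h0
        refine ⟨1, tendsto_const_nhds.congr' (Filter.Eventually.of_forall fun y => ?_)⟩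
        show (1:ℝ) = rescaledCorrelator (criticalCorr 3) rho1 0 y.1 y.2
        rw [rescaledCorrelator_apply, pow_zero, one_mul,
          hE 0 _ (Function.injective_of_subsingleton _)]
        exact (Pr_even_zero _).symm
      · have hn2 : 2 ≤ n := by obtain ⟨k, rfl⟩ := hn; omega
        obtain ⟨L, -, hL⟩ := tendsto_rescaled_even hB hC hE hn2 hn hz
        exact ⟨L, hL⟩
    · refine ⟨0, tendsto_const_nhds.congr' ?_⟩
      filter_upwards [eventually_injective_latticeApprox hz] with y hy
      rw [rescaledCorrelator_apply, hE n _ hy,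
        Pr_even_eq_zero_of_odd hn (fun i => latticeApprox y.1 (y.2 i)), mul_zero]
  refine ⟨fun n z => limUnder (𝓝[>] (0:ℝ)) fun δ => rescaledCorrelator (criticalCorr 3) rho1 n δ z,
    ?_, ?_⟩
  · intro n
    exact tendstoLocallyUniformlyOn_limUnder (key n)
  · intro z hz
    obtain ⟨L, hL0, hL⟩ :=
      tendsto_rescaled_even hB hC hE le_rfl even_two ((mem_nonCoincident z).1 hz)
    have hz' : Tendsto (fun δ : ℝ => (δ, z)) (𝓝[>] (0:ℝ)) ((𝓝[>] (0:ℝ)) ×ˢ 𝓝 z) :=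
      tendsto_id.prodMk tendsto_const_nhds
    have hpt := hL.comp hz'
    have hpt' : Tendsto (fun δ : ℝ => rescaledCorrelator (criticalCorr 3) rho1 2 δ z) (𝓝[>] (0:ℝ))
        (𝓝 L) := hpt
    dsimp only
    rw [hpt'.limUnder_eq]
    exact hL0

end Summit.CriticalPhenomena.Ising3DConformalLimit.Cruxes.ArmDressingGlue.DressedLimitProof

end
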